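import Literature.NumberTheory.LFunctions.YoshidaWindowGramTailJ
import HarnessLib

/-!
# Kernel enclosures of Yoshida's matrix coefficients — VII-b: boxes of the even order-`J` tail matrix `U₂⁺`

Source: H. Yoshida, Adv. Stud. Pure Math. **21** (1992) 281–325, §§6–7 [Yoshida1992HermitianForms].  Kernel
enclosures (`MI` boxes at scale `S`) of the order-`J` tail matrices `U₂⁺`, `U₂⁻` of
`WeilFormatC.weilPositivityOn_of_formatC_dataJ` (part VII-a: `Encl.U2EvenJ`, `Encl.U2OddJ`), built from the constants
record, the front-door constants (part V) and the special-value table.  This file: generic sum/power boxes, the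
boxes of the atoms (`C_F`, `C_A⁺`, `q`, the mode function `F_n`, the Hankel entries, `v^A`, `v^B`, `ρ⁺`) and
`Encl.u2EvenJBox` with `mem_u2EvenJBox` (`θ = θn/θd`, `η = ηn/ηd`, `d₀ = d0z·2^{−cd}`).  The odd box and the packaging
of the door's `hS` hypotheses are part VII-c (`YoshidaWindowGramFrontDoorJ.lean`).  Everything is proved; no named facts.
-/

open Real Complex Finset Matrix
open scoped BigOperators

namespace Literature.NumberTheory.LFunctions.Yoshida1992

open Literature.Analysis.SpecialFunctions Literature.Analysis.ValidatedNumerics.NumericsMP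
open Literature.Analysis.ValidatedNumerics
open scoped ArithmeticFunction.vonMangoldt

namespace Encl

variable {S : ℕ} {a : ℝ} {prm : Params} {ks : List PrimeLen} {C : Consts} {tab ctab : List IdxRec}

/-! ## Generic boxes: finite sums and natural powers -/

/-- `Σ_{j<n} f j` as a box. [cite: Moore1966, Ch. 3 (interval arithmetic: inclusion property)] -/
def sumBox (S : ℕ) (f : ℕ → MI) : ℕ → MI
  | 0 => MI.ofInt S 0
  | n + 1 => (sumBox S f n).add (f n)

/-- [cite: Moore1966, Ch. 3 (interval arithmetic: inclusion property)] -/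
theorem mem_sumBox (S : ℕ) {f : ℕ → MI} {g : ℕ → ℝ} :
    ∀ n : ℕ, (∀ j < n, MI.mem S (g j) (f j)) → MI.mem S (∑ j ∈ Finset.range n, g j) (sumBox S f n)
  | 0, _ => by simpa [sumBox] using MI.mem_ofInt S 0
  | n + 1, h => by
      rw [Finset.sum_range_succ, sumBox]
      exact MI.mem_add (mem_sumBox S n fun j hj ↦ h j (by omega)) (h n (by omega))

/-- `x^n` as a box. [cite: Moore1966, Ch. 3 (interval arithmetic: inclusion property)] -/
def powBox (S : ℕ) (X : MI) : ℕ → MI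
  | 0 => MI.ofInt S 1
  | n + 1 => (powBox S X n).mul S X

/-- [cite: Moore1966, Ch. 3 (interval arithmetic: inclusion property)] -/
theorem mem_powBox (hS : 0 < S) {x : ℝ} {X : MI} (hx : MI.mem S x X) :
    ∀ n : ℕ, MI.mem S (x ^ n) (powBox S X n)
  | 0 => by simpa [powBox] using MI.mem_ofInt S 1
  | n + 1 => by
      rw [pow_succ, powBox]
      exact MI.mem_mul hS (mem_powBox hS hx n) hx

/-! ## Boxes of the atoms -/

/-- box of `C_F`. [cite: Moore1966, Ch. 3 (interval arithmetic: inclusion property)] -/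
def cFBox (S : ℕ) (C : Consts) (F : FDConsts) : MI := ((C.P.divNat 4).add F.A1).add (F.Ca.mul S C.invPi)

/-- [cite: Moore1966, Ch. 3 (interval arithmetic: inclusion property)] -/
theorem mem_cFBox (hS : 0 < S) (hC : ConstsValid S a ks C) {F : FDConsts} (hF : FDValid S a F) :
    MI.mem S (cF a) (cFBox S C F) := by
  unfold cF cFBox
  have h := MI.mem_add (MI.mem_add (MI.mem_divNat hC.pi (n := 4) (by norm_num)) hF.A1) (MI.mem_mul hS hF.Ca hC.invPi)
  refine mem_of_eq h ?_
  push_cast; ring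

/-- box of `C_A⁺`. [cite: Moore1966, Ch. 3 (interval arithmetic: inclusion property)] -/
def cAeBox (S : ℕ) (C : Consts) (F : FDConsts) (B3e : ℕ) : MI :=
  ((C.P.divNat 4).add F.A1).add ((F.Ca.mul S C.invPi).divNat B3e)

/-- [cite: Moore1966, Ch. 3 (interval arithmetic: inclusion property)] -/
theorem mem_cAeBox (hS : 0 < S) (hC : ConstsValid S a ks C) {F : FDConsts} (hF : FDValid S a F) {B3e : ℕ}
    (hB : 0 < B3e) : MI.mem S (cAe a B3e) (cAeBox S C F B3e) := by
  unfold cAe cAeBox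
  have h := MI.mem_add (MI.mem_add (MI.mem_divNat hC.pi (n := 4) (by norm_num)) hF.A1)
    (MI.mem_divNat (MI.mem_mul hS hF.Ca hC.invPi) hB)
  refine mem_of_eq h ?_
  have hπ : (π : ℝ) ≠ 0 := Real.pi_ne_zero
  have hB' : (B3e : ℝ) ≠ 0 := by exact_mod_cast hB.ne'
  push_cast
  field_simp

/-- box of `q = a²/(4π²)`. [cite: Moore1966, Ch. 3 (interval arithmetic: inclusion property)] -/
def qqBox (S : ℕ) (C : Consts) (F : FDConsts) : MI := ((C.A.sqr S).mul S F.invPi2).divNat 4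

/-- [cite: Moore1966, Ch. 3 (interval arithmetic: inclusion property)] -/
theorem mem_qqBox (hS : 0 < S) (hC : ConstsValid S a ks C) {F : FDConsts} (hF : FDValid S a F) :
    MI.mem S (qq a) (qqBox S C F) := by
  unfold qq qqBox
  have h := MI.mem_divNat (MI.mem_mul hS (MI.mem_sqr hS hC.ha) hF.invPi2) (n := 4) (by norm_num)
  refine mem_of_eq h ?_
  have hπ : (π : ℝ) ≠ 0 := Real.pi_ne_zero
  push_cast
  field_simp

/-- box of the mode function `F_n` from a record valid at `n`. [cite: Moore1966, Ch. 3 (interval arithmetic: inclusion property)] -/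
def modeFBox (S : ℕ) (C : Consts) (R : IdxRec) : MI :=
  ((R.imP.divNat 2).add (sinSum S C.wts R.cs C.wts.length)).sub R.eS

/-- [cite: Moore1966, Ch. 3 (interval arithmetic: inclusion property)] -/
theorem mem_modeFBox (hS : 0 < S) (hks : PrimeData a ks) (hC : ConstsValid S a ks C) {n : ℤ} {R : IdxRec}
    (hR : OffValid S a ks n R) : MI.mem S (modeF a n) (modeFBox S C R) := by
  unfold modeF modeFBox
  have hsin : ∑ j ∈ weilPrimeIndex a, (Λ j : ℝ) / Real.sqrt j * Real.sin (freq a n * Real.log j)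
      = ∑ i ∈ Finset.range ks.length, (ks.getD i default).wt * Real.sin (freq a n * (ks.getD i default).len) := by
    rw [sum_weilPrimeIndex_eq_listSum hks, list_sum_map_eq_sum_range]
    refine Finset.sum_congr rfl fun i _ ↦ by rw [PrimeLen.log_val]
  rw [hsin, hC.wts_len]
  have h := MI.mem_sub (MI.mem_add (MI.mem_divNat hR.imP (n := 2) (by norm_num))
    (mem_sinSum hS hC hR ks.length le_rfl)) hR.eS
  refine mem_of_eq h ?_
  push_cast; ring

/-- box of `hankP`. [cite: Moore1966, Ch. 3 (interval arithmetic: inclusion property)] -/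
def hankPBox (S : ℕ) (e X Y : ℕ) : MI := ((MI.ofFrac S 1 (e * X ^ e)).add (MI.ofFrac S 1 (e * Y ^ e))).divNat 2

/-- [cite: Moore1966, Ch. 3 (interval arithmetic: inclusion property)] -/
theorem mem_hankPBox (S : ℕ) {e X Y : ℕ} (he : 0 < e) (hX : 0 < X) (hY : 0 < Y) :
    MI.mem S (hankP e X Y) (hankPBox S e X Y) := by
  unfold hankP hankPBox
  have h := MI.mem_divNat (MI.mem_add (MI.mem_ofFrac S 1 (q := e * X ^ e) (by positivity))
    (MI.mem_ofFrac S 1 (q := e * Y ^ e) (by positivity))) (n := 2) (by norm_num)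
  refine mem_of_eq h ?_
  push_cast; ring

/-- box of `hankM`. [cite: Moore1966, Ch. 3 (interval arithmetic: inclusion property)] -/
def hankMBox (S : ℕ) (e X Y : ℕ) : MI := ((MI.ofFrac S 1 (e * X ^ e)).sub (MI.ofFrac S 1 (e * Y ^ e))).divNat 2

/-- [cite: Moore1966, Ch. 3 (interval arithmetic: inclusion property)] -/
theorem mem_hankMBox (S : ℕ) {e X Y : ℕ} (he : 0 < e) (hX : 0 < X) (hY : 0 < Y) :
    MI.mem S (hankM e X Y) (hankMBox S e X Y) := by
  unfold hankM hankMBox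
  have h := MI.mem_divNat (MI.mem_sub (MI.mem_ofFrac S 1 (q := e * X ^ e) (by positivity))
    (MI.mem_ofFrac S 1 (q := e * Y ^ e) (by positivity))) (n := 2) (by norm_num)
  refine mem_of_eq h ?_
  push_cast; ring

/-- box of `hankH`. [cite: Moore1966, Ch. 3 (interval arithmetic: inclusion property)] -/
def hankHBox (S : ℕ) (p : ℕ → ℕ) (X Y B Je : ℕ) (j j' : ℕ) : MI :=
  (hankPBox S (p j + p j' - 1) X Y).add
    (if j = j' then sumBox S (fun j'' ↦ ((hankMBox S (p j + p j'' - 1) X Y).mulInt ((B : ℤ) ^ p j'')).divNat (B ^ p j)) Je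
      else MI.ofInt S 0)

/-- [cite: Moore1966, Ch. 3 (interval arithmetic: inclusion property)] -/
theorem mem_hankHBox (S : ℕ) {p : ℕ → ℕ} (hp : ∀ j, 1 ≤ p j) {X Y B Je : ℕ} (hX : 0 < X) (hY : 0 < Y) (hB : 0 < B)
    (j j' : ℕ) : MI.mem S (hankH p X Y B Je j j') (hankHBox S p X Y B Je j j') := by
  unfold hankH hankHBox
  refine MI.mem_add (mem_hankPBox S (by have := hp j; have := hp j'; omega) hX hY) ?_
  split_ifs with h
  · refine mem_sumBox S Je fun j'' _ ↦ ?_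
    have hm := MI.mem_divNat (MI.mem_mulInt (mem_hankMBox S (e := p j + p j'' - 1) (by have := hp j; have := hp j''; omega) hX hY)
      ((B : ℤ) ^ p j'')) (n := B ^ p j) (by positivity)
    refine mem_of_eq hm ?_
    push_cast; ring
  · simpa using MI.mem_ofInt S 0

/-- box of `v^A_j(i)` (an integer). [cite: Moore1966, Ch. 3 (interval arithmetic: inclusion property)] -/
def vAeBox (S : ℕ) (i j : ℕ) : MI := MI.ofInt S ((-1) ^ i * (i : ℤ) ^ (2 * j))

/-- [cite: Moore1966, Ch. 3 (interval arithmetic: inclusion property)] -/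
theorem mem_vAeBox (S : ℕ) (i j : ℕ) : MI.mem S (vAe i j) (vAeBox S i j) := by
  unfold vAe vAeBox
  refine mem_of_eq (MI.mem_ofInt S _) ?_
  push_cast; ring

/-- box of `v^B_r(i)` from the record at mode `i`. [cite: Moore1966, Ch. 3 (interval arithmetic: inclusion property)] -/
def vBeBox (S : ℕ) (C : Consts) (F : FDConsts) (R : IdxRec) (i r : ℕ) : MI :=
  (MI.ofInt S ((-1) ^ i)).mul S
    ((((MI.ofInt S (-((i : ℤ) ^ (2 * r + 1)))).mul S (modeFBox S C R)).mul S C.invPi).add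
      (((((C.invA.mulInt 4).mul S F.s2).mul S (MI.ofInt S ((-1) ^ r))).mul S (powBox S (qqBox S C F) (r + 1))).mul S R.c))

/-- [cite: Moore1966, Ch. 3 (interval arithmetic: inclusion property)] -/
theorem mem_vBeBox (hS : 0 < S) (hks : PrimeData a ks) (hC : ConstsValid S a ks C) {F : FDConsts} (hF : FDValid S a F)
    {i r : ℕ} {R : IdxRec} (hR : OffValid S a ks (i : ℤ) R) : MI.mem S (vBe a i r) (vBeBox S C F R i r) := by
  unfold vBe vBeBox s2r ccoef
  have hq := mem_powBox hS (mem_qqBox hS hC hF) (r + 1)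
  have h := MI.mem_mul hS (MI.mem_ofInt S ((-1) ^ i))
    (MI.mem_add (MI.mem_mul hS (MI.mem_mul hS (MI.mem_ofInt S (-((i : ℤ) ^ (2 * r + 1)))) (mem_modeFBox hS hks hC hR))
      hC.invPi)
      (MI.mem_mul hS (MI.mem_mul hS (MI.mem_mul hS (MI.mem_mul hS (MI.mem_mulInt hC.invA 4) hF.s2)
        (MI.mem_ofInt S ((-1) ^ r))) hq) hR.c))
  refine mem_of_eq h ?_
  push_cast; ring

/-- box of `ρ⁺_i` from the record at mode `i`. [cite: Moore1966, Ch. 3 (interval arithmetic: inclusion property)] -/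
def rhoEBox (S : ℕ) (C : Consts) (F : FDConsts) (R : IdxRec) (Je i : ℕ) : MI :=
  (((cFBox S C F).mulInt (2 * (i : ℤ) ^ (2 * Je))).mul S C.invPi).add
    ((((C.invA.mulInt 4).mul S F.s2).mul S (powBox S (qqBox S C F) (Je + 1))).mul S R.c)

/-- [cite: Moore1966, Ch. 3 (interval arithmetic: inclusion property)] -/
theorem mem_rhoEBox (hS : 0 < S) (hC : ConstsValid S a ks C) {F : FDConsts} (hF : FDValid S a F)
    {Je i : ℕ} {R : IdxRec} (hR : OffValid S a ks (i : ℤ) R) : MI.mem S (rhoE a Je i) (rhoEBox S C F R Je i) := by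
  unfold rhoE rhoEBox s2r ccoef
  have hq := mem_powBox hS (mem_qqBox hS hC hF) (Je + 1)
  have h := MI.mem_add (MI.mem_mul hS (MI.mem_mulInt (mem_cFBox hS hC hF) (2 * (i : ℤ) ^ (2 * Je))) hC.invPi)
    (MI.mem_mul hS (MI.mem_mul hS (MI.mem_mul hS (MI.mem_mulInt hC.invA 4) hF.s2) hq) hR.c)
  refine mem_of_eq h ?_
  push_cast; ring

/-! ## The box of `U₂⁺` -/

/-- **Kernel box of `U₂⁺(i,i')`** for the order-`J` door: `θ = θn/θd`, `η = ηn/ηd`, `d₀ = d0z·2^{−cd}`; records of the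
block modes `i, i'` from the table. [cite: Yoshida1992HermitianForms, §7 pp. 305–312] -/
def u2EvenJBox (S : ℕ) (C : Consts) (F : FDConsts) (tab : List IdxRec) (cd d0z Be B3e Je θn θd ηn ηd : ℕ)
    (i i' : ℕ) : MI :=
  let cA := ((((cAeBox S C F B3e).sqr S).mul S F.invPi2).mulInt (((θd + θn) * (ηd + ηn) * 2 ^ cd : ℕ) : ℤ)).divNat
    (θd * ηd * d0z)
  let tA := sumBox S (fun j ↦ sumBox S (fun j' ↦
    ((hankHBox S pA (B3e - 1) B3e Be Je j j').mul S (vAeBox S i j)).mul S (vAeBox S i' j')) Je) Je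
  let cB := ((MI.ofInt S 1).mulInt (((θd + θn) * (ηn + ηd) * 2 ^ cd : ℕ) : ℤ)).divNat (θd * ηn * d0z)
  let tB := sumBox S (fun r ↦ sumBox S (fun r' ↦
    ((hankHBox S pB (B3e - 1) B3e Be Je r r').mul S (vBeBox S C F (tget tab i) i r)).mul S
      (vBeBox S C F (tget tab i') i' r')) Je) Je
  let t := (cA.mul S tA).add (cB.mul S tB)
  if i = i' then
    t.add ((((MI.ofInt S 1).mulInt (((θn + θd) * Be * 2 ^ cd : ℕ) : ℤ)).divNat
      (θn * d0z * (4 * Je + 1) * (B3e - 1) ^ (4 * Je + 1))).mul S ((rhoEBox S C F (tget tab i) Je i).sqr S))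
  else t

/-- **`u2EvenJBox ∋ U₂⁺(i,i')`** (table valid below `N`, `i, i' < N`). [cite: Yoshida1992HermitianForms, §7 pp. 305–312] -/
theorem mem_u2EvenJBox (hS : 0 < S) (hks : PrimeData a ks) (hC : ConstsValid S a ks C) {F : FDConsts}
    (hF : FDValid S a F) {tab : List IdxRec} {N : ℕ} (hT : TabValid S a ks N tab)
    {cd d0z Be B3e Je θn θd ηn ηd : ℕ} (hd0 : 0 < d0z) (hθn : 0 < θn) (hθd : 0 < θd) (hηn : 0 < ηn) (hηd : 0 < ηd)
    (hBe : 0 < Be) (hB3 : 2 ≤ B3e) {i i' : ℕ} (hi : i < N) (hi' : i' < N) :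
    MI.mem S (U2EvenJ a ((θn : ℝ) / θd) ((ηn : ℝ) / ηd) ((d0z : ℝ) * (1 / 2 ^ cd)) Be B3e Je i i')
      (u2EvenJBox S C F tab cd d0z Be B3e Je θn θd ηn ηd i i') := by
  rw [← U2EvenJ'_eq]
  have hRi : OffValid S a ks (i : ℤ) (tget tab i) := (hT i hi).1
  have hRi' : OffValid S a ks (i' : ℤ) (tget tab i') := (hT i' hi').1
  have hX : 0 < B3e - 1 := by omega
  have hπ : (π : ℝ) ≠ 0 := Real.pi_ne_zero
  have hθd' : (θd : ℝ) ≠ 0 := by exact_mod_cast hθd.ne'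
  have hθn' : (θn : ℝ) ≠ 0 := by exact_mod_cast hθn.ne'
  have hηd' : (ηd : ℝ) ≠ 0 := by exact_mod_cast hηd.ne'
  have hηn' : (ηn : ℝ) ≠ 0 := by exact_mod_cast hηn.ne'
  have hd0' : (d0z : ℝ) ≠ 0 := by exact_mod_cast hd0.ne'
  have h2 : (2 : ℝ) ^ cd ≠ 0 := by positivity
  have hpA : ∀ j, 1 ≤ pA j := fun j ↦ by simp [pA]
  have hpB : ∀ j, 1 ≤ pB j := fun j ↦ by simp [pB]
  -- scalar factors
  have hcA : MI.mem S ((1 + (θn : ℝ) / θd) * (1 + (ηn : ℝ) / ηd) * (cAe a B3e ^ 2 / (π ^ 2 * ((d0z : ℝ) * (1 / 2 ^ cd)))))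
      (((((cAeBox S C F B3e).sqr S).mul S F.invPi2).mulInt (((θd + θn) * (ηd + ηn) * 2 ^ cd : ℕ) : ℤ)).divNat
        (θd * ηd * d0z)) := by
    have h := MI.mem_divNat (MI.mem_mulInt (MI.mem_mul hS (MI.mem_sqr hS (mem_cAeBox hS hC hF (B3e := B3e) (by omega)))
      hF.invPi2) (((θd + θn) * (ηd + ηn) * 2 ^ cd : ℕ) : ℤ)) (n := θd * ηd * d0z) (by positivity)
    refine mem_of_eq h ?_
    push_cast
    field_simp
  have hcB : MI.mem S ((1 + (θn : ℝ) / θd) * (1 + ((ηn : ℝ) / ηd)⁻¹) * (1 / ((d0z : ℝ) * (1 / 2 ^ cd))))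
      (((MI.ofInt S 1).mulInt (((θd + θn) * (ηn + ηd) * 2 ^ cd : ℕ) : ℤ)).divNat (θd * ηn * d0z)) := by
    have h := MI.mem_divNat (MI.mem_mulInt (MI.mem_ofInt S 1) (((θd + θn) * (ηn + ηd) * 2 ^ cd : ℕ) : ℤ))
      (n := θd * ηn * d0z) (by positivity)
    refine mem_of_eq h ?_
    push_cast
    field_simp
  have hcR : MI.mem S ((1 + ((θn : ℝ) / θd)⁻¹) * ((Be : ℝ) / ((d0z : ℝ) * (1 / 2 ^ cd) *
      ((4 * Je + 1 : ℕ) * (((B3e - 1 : ℕ) : ℝ)) ^ (4 * Je + 1)))))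
      (((MI.ofInt S 1).mulInt (((θn + θd) * Be * 2 ^ cd : ℕ) : ℤ)).divNat
        (θn * d0z * (4 * Je + 1) * (B3e - 1) ^ (4 * Je + 1))) := by
    have h := MI.mem_divNat (MI.mem_mulInt (MI.mem_ofInt S 1) (((θn + θd) * Be * 2 ^ cd : ℕ) : ℤ))
      (n := θn * d0z * (4 * Je + 1) * (B3e - 1) ^ (4 * Je + 1)) (by positivity)
    refine mem_of_eq h ?_
    have hX' : (((B3e - 1 : ℕ) : ℝ)) ≠ 0 := by exact_mod_cast hX.ne'
    push_cast
    field_simp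
  -- the two Gram sums
  have htA : MI.mem S (∑ j ∈ Finset.range Je, ∑ j' ∈ Finset.range Je,
      hankH pA (B3e - 1) B3e Be Je j j' * vAe i j * vAe i' j')
      (sumBox S (fun j ↦ sumBox S (fun j' ↦
        ((hankHBox S pA (B3e - 1) B3e Be Je j j').mul S (vAeBox S i j)).mul S (vAeBox S i' j')) Je) Je) :=
    mem_sumBox S Je fun j _ ↦ mem_sumBox S Je fun j' _ ↦
      MI.mem_mul hS (MI.mem_mul hS (mem_hankHBox S hpA hX (by omega) hBe j j') (mem_vAeBox S i j)) (mem_vAeBox S i' j')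
  have htB : MI.mem S (∑ r ∈ Finset.range Je, ∑ r' ∈ Finset.range Je,
      hankH pB (B3e - 1) B3e Be Je r r' * vBe a i r * vBe a i' r')
      (sumBox S (fun r ↦ sumBox S (fun r' ↦
        ((hankHBox S pB (B3e - 1) B3e Be Je r r').mul S (vBeBox S C F (tget tab i) i r)).mul S
          (vBeBox S C F (tget tab i') i' r')) Je) Je) :=
    mem_sumBox S Je fun r _ ↦ mem_sumBox S Je fun r' _ ↦
      MI.mem_mul hS (MI.mem_mul hS (mem_hankHBox S hpB hX (by omega) hBe r r') (mem_vBeBox hS hks hC hF hRi))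
        (mem_vBeBox hS hks hC hF hRi')
  have ht := MI.mem_add (MI.mem_mul hS hcA htA) (MI.mem_mul hS hcB htB)
  unfold U2EvenJ' u2EvenJBox
  simp only
  by_cases hii : i = i'
  · subst hii
    simp only [if_true]
    exact MI.mem_add ht (MI.mem_mul hS hcR (MI.mem_sqr hS (mem_rhoEBox hS hC hF hRi)))
  · simp only [hii, if_false, add_zero]
    exact ht


end Encl

end Literature.NumberTheory.LFunctions.Yoshida1992
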